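import Literature.Topology.FourManifolds.LefschetzHandlebody
import Literature.Topology.FourManifolds.BoundaryGluingRelHomology
import Literature.Topology.FourManifolds.BoundaryManifoldHomologyVanishing
import Literature.Topology.FourManifolds.TrisectionEulerProofs
import Literature.AlgebraicTopology.SingularHomology.EulerCharacteristicTriple
import Literature.AlgebraicTopology.SingularHomology.IntersectionFormProofs
import Literature.AlgebraicTopology.SingularHomology.WuClasses
import Literature.AlgebraicTopology.SingularHomology.ModPBettiNumbers
import Mathlib.LinearAlgebra.Dimension.Localization
import HarnessLib

/-!
# The count `l.length = 4 * g` of a one-sided Lefschetz model of a homotopy 4-sphere, from the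
# Betti numbers of the base and the Euler characteristic of 2-handle attachments
(sub-goal `stub_modelsOn_counts_length_of_betti` of stub `stub_modelsOn_counts`, line `modp-braid-orbits`,
reshape r9, crux `ConvexBisection.AcyclicBisectionExists`, item stmt-SmoothPoincare4-10508)

The first clause of the named fact `LefschetzBase.modelsOn_counts_of_homotopyEquiv_sphere`
(Gompf–Stipsicz 1999, §8.2; Etnyre–Fuller 2006, §2): if `M ≃ₕ S⁴` and `ModelsOn M g l` — `M` is a
boundary gluing `X ∪_Ψ Base g` of a Lefschetz handlebody `X` (the base `Base g` with `l.length`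
2-handles attached, `HandleAttachingMap.IsMultiAttachment`) and the base — then `l.length = 4 * g`.
On paper: `2 = χ(M) = χ(X) + χ(Base g) - χ(∂ Base g)`, `χ(X) = χ(Base g) + l.length`,
`χ(∂ Base g) = 0`, `χ(Base g) = χ(F_{g,1} × D²) = 1 - 2g`.  This file PROVES the count
(`stub_modelsOn_counts_length_of_betti`) from two explicit inputs which are not in the tree:

* `hχ` — the Euler characteristic of a Kosinski multi-attachment of `n` 2-handles on the base,
  `χ(X) = χ(Base g) + n` (Kosinski 1993 VI §6 / Kirby 1989 I §1; proved for the tree's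
  `IsMultiAttachment` in the companion files `…EulerHandles*.lean` of this wave, not importable yet);
* `hB` — the rational Betti numbers of the concrete base, `b₀ = 1`, `b₁ = 2g`, `bₖ = 0` (`k ≥ 2`)
  (Milnor 1968, Thm. 9.1: `Base g ≃ F_{g,1} × D² ≃ ⋁^{2g} S¹`; the debt D0 of the line);

everything else is proved here: `χ(M) = 2` for `M ≃ₕ S⁴` (the tree's
`finRelHomology_of_homotopyEquiv_sphere_four`), `χ(∂ Base g) = 0` (closed 3-manifolds have `χ = 0`:
`𝔽₂`-Poincaré duality `bₖ = b_{3-k}`, the tree's `bettiNumber_eq_bettiNumber_of_add_eq_holds` with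
`modTwoOrientation`, and `eulerChar_int_eq_eulerChar_zmod`), the gluing count
`χ(A ∪_φ B) = χ(A) + χ(B) - χ(∂A)` (Hatcher Thm. 2.44 along the triples `∅ ⊆ jA A ⊆ M`,
`∅ ⊆ ∂B ⊆ B` and the tree's excision for gluings `BoundaryGluingData.isIso_map_jB_boundary'`; these
are `private` copies of the accepted, not yet built, companion `…EulerGluing.lean` of this wave), and the
passage `χ(Base g) = Σ (-1)ᵏ bₖ(Base g; ℚ) = 1 - 2g` (`bettiNumber_int_eq_rat`).

No definitions, no named facts, no `sorry`.
-/

noncomputable section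

-- the prescribed namespace `Summit.<P>.<Sub>.…` duplicates `SmoothPoincare4` (P = Sub)
set_option linter.dupNamespace false

open scoped Manifold ContDiff Topology ContinuousMap
open Set Function CategoryTheory CategoryTheory.Limits
open Literature.AlgebraicTopology.SingularHomology Literature.Topology.FourManifolds
  Literature.Topology.FourManifolds.LefschetzBase

namespace Summit.SmoothPoincare4.SmoothPoincare4.Theorems.AcyclicBisectionExists.ModpBraidOrbits

/-! ## Private copies of the gluing count (`…EulerGluing.lean`, accepted, not yet built) -/

section Copies

/-- A closed topological `n`-manifold has finitely generated integral homology, zero above degree `n`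
(Hatcher App. A Cor. A.8–A.9, Thm. 3.26(c)).  Private copy of `finRelHomology_of_closedManifold`.
[folklore] -/
private theorem finRelHomology_of_closedManifold' {n : ℕ} (Y : Type) [TopologicalSpace Y] [CompactSpace Y]
    [T2Space Y] [ChartedSpace (EuclideanSpace ℝ (Fin n)) Y] : FinRelHomology ℤ ℤ Y ∅ (n + 1) :=
  FinRelHomology.empty_of_absolute
    (fun k => finite_singularHomology_of_compact_chartedSpace ℤ ℤ (d := n) k)
    (fun k hk => isZero_singularHomology_of_lt_holds ℤ ℤ Y n (by omega))

/-- **`χ = 0` for a closed topological manifold of odd dimension** (Hatcher Cor. 3.37 over `𝔽₂`,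
`modTwoOrientation`, `eulerChar_int_eq_eulerChar_zmod`).  Private copy of `relEuler_eq_zero_of_odd`.
[folklore] -/
private theorem relEuler_eq_zero_of_odd' {n : ℕ} (hn : Odd n) (Y : Type) [TopologicalSpace Y]
    [CompactSpace Y] [T2Space Y] [ChartedSpace (EuclideanSpace ℝ (Fin n)) Y] :
    relEuler ℤ ℤ Y ∅ = 0 := by
  have hF := finRelHomology_of_closedManifold' (n := n) Y
  rw [hF.relEuler_empty_eq_sum, eulerChar_int_eq_eulerChar_zmod (p := 2) n Y]
  set b : ℕ → ℤ := fun k => (Module.finrank (ZMod 2) (singularHomology (ZMod 2) (ZMod 2) Y k) : ℤ)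
    with hb
  have hsymm : ∀ k, k ≤ n → b (n - k) = b k := fun k hk => by
    simp only [hb]
    exact_mod_cast bettiNumber_eq_bettiNumber_of_add_eq_holds (ZMod 2) Y n ⟨modTwoOrientation Y n⟩
      (show (n - k) + k = n by omega)
  have hsign : ∀ k, k ≤ n → (-1 : ℤ) ^ (n - k) = -(-1) ^ k := fun k hk => by
    have h1 : (-1 : ℤ) ^ (n - k) * (-1) ^ k = -1 := by
      rw [← pow_add, Nat.sub_add_cancel hk, hn.neg_one_pow]
    have h2 : ((-1 : ℤ) ^ k) * (-1) ^ k = 1 := by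
      rw [← pow_add, ← two_mul, pow_mul, neg_one_sq, one_pow]
    calc (-1 : ℤ) ^ (n - k) = (-1) ^ (n - k) * (-1) ^ k * (-1) ^ k := by rw [mul_assoc, h2, mul_one]
      _ = -(-1) ^ k := by rw [h1, neg_one_mul]
  have hrefl := Finset.sum_range_reflect (fun k => (-1 : ℤ) ^ k * b k) (n + 1)
  have hS : ∑ k ∈ Finset.range (n + 1), (-1 : ℤ) ^ k * b k =
      -∑ k ∈ Finset.range (n + 1), (-1 : ℤ) ^ k * b k := by
    conv_lhs => rw [← hrefl]
    rw [← Finset.sum_neg_distrib]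
    refine Finset.sum_congr rfl fun k hk => ?_
    have hk' : k ≤ n := Nat.lt_succ_iff.mp (Finset.mem_range.mp hk)
    simp only [show n + 1 - 1 - k = n - k by omega]
    rw [hsymm k hk', hsign k hk', neg_mul]
  change ∑ k ∈ Finset.range (n + 1), (-1 : ℤ) ^ k * b k = 0
  linarith

variable {A : Type} [TopologicalSpace A] [T2Space A] [SecondCountableTopology A] [CompactSpace A]
  [ChartedSpace (EuclideanHalfSpace (2 + 1 + 1)) A] [IsManifold (𝓡∂ (2 + 1 + 1)) ∞ A]
  {B : Type} [TopologicalSpace B] [T2Space B] [SecondCountableTopology B] [CompactSpace B]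
  [ChartedSpace (EuclideanHalfSpace (2 + 1 + 1)) B] [IsManifold (𝓡∂ (2 + 1 + 1)) ∞ B]
  {M : Type} [TopologicalSpace M] [ChartedSpace (EuclideanSpace ℝ (Fin (2 + 1 + 1))) M]
  [IsManifold (𝓡 (2 + 1 + 1)) ∞ M]

/-- `Hₖ(B, ∂B) ≅ Hₖ(M, jA A)` in Euler-characteristic form for gluing data of `M = A ∪_φ B`
(Hatcher Thm. 2.20 / Prop. 2.22, the tree's `BoundaryGluingData.isIso_map_jB_boundary'`; plain
excision of the clopen piece when `∂B = ∅`; Thm. 2.44 for `∅ ⊆ ∂B ⊆ B`).  Private copy of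
`finRelHomology_and_relEuler_range_jA` at `m = 2`, integer coefficients. [folklore] -/
private theorem finRelHomology_and_relEuler_range_jA' (bA : BoundaryData (𝓡∂ (2 + 1 + 1)) A (𝓡 (2 + 1)))
    (bB : BoundaryData (𝓡∂ (2 + 1 + 1)) B (𝓡 (2 + 1)))
    (φ : bA.carrier ≃ₘ⟮𝓡 (2 + 1), 𝓡 (2 + 1)⟯ bB.carrier)
    (G : BoundaryGluingData bA bB φ.toEquiv M) :
    FinRelHomology ℤ ℤ M (range G.jA) 6 ∧
      relEuler ℤ ℤ M (range G.jA) = relEuler ℤ ℤ B ∅ - relEuler ℤ ℤ bB.carrier ∅ := by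
  haveI : CompactSpace bB.carrier := bB.compactSpace_carrier
  haveI : T2Space bB.carrier := bB.isSmoothEmbedding.isEmbedding.t2Space
  -- (1) the triple `∅ ⊆ ∂B ⊆ B`
  set dB : Set B := (𝓡∂ (2 + 1 + 1)).boundary B with hdB
  let eB : bB.carrier ≃ₜ ↥dB :=
    bB.isSmoothEmbedding.isEmbedding.toHomeomorph.trans (Homeomorph.setCongr bB.range_incl)
  have hSB : FinRelHomology ℤ ℤ (↥dB) (Subtype.val ⁻¹' (∅ : Set B)) 5 := by
    rw [preimage_empty]
    exact ((finRelHomology_of_closedManifold' (n := 2 + 1) bB.carrier).of_homeomorph eB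
      (mapsTo_empty _ _) (mapsTo_empty _ _)).mono (by omega)
  have hSBe : relEuler ℤ ℤ (↥dB) (Subtype.val ⁻¹' (∅ : Set B)) = relEuler ℤ ℤ bB.carrier ∅ := by
    rw [preimage_empty]
    exact (relEuler_eq_of_homeomorph eB (mapsTo_empty _ _) (mapsTo_empty _ _)).symm
  have hB0 : FinRelHomology ℤ ℤ B ∅ 5 := finRelHomology_of_compactSpace_halfSpace (n := 2 + 1) B
  obtain ⟨hBd, hBde⟩ := FinRelHomology.triple_right (R := ℤ) (M := ℤ) (empty_subset dB) hSB hB0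
  rw [hSBe] at hBde
  -- (2) `H_•(M, jA A) ≅ H_•(B, ∂B)`
  suffices h : FinRelHomology ℤ ℤ M (range G.jA) 6 ∧
      relEuler ℤ ℤ M (range G.jA) = relEuler ℤ ℤ B dB by
    exact ⟨h.1, by rw [h.2]; linarith⟩
  rcases isEmpty_or_nonempty bB.carrier with hE | hN
  · have hdBempty : dB = ∅ := by
      rw [hdB, ← bB.range_incl]
      exact range_eq_empty _
    have hdisj : Disjoint (range G.jA) (range G.jB) := by
      rw [Set.disjoint_left]
      rintro _ ⟨a, rfl⟩ ⟨b, hb⟩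
      obtain ⟨z, -, -⟩ := (G.jA_eq_jB_iff a b).mp hb.symm
      exact hE.elim (φ z)
    have hcompl : (range G.jA)ᶜ = range G.jB := by
      refine Set.Subset.antisymm (fun x hx => ?_) fun x hx hx' => Set.disjoint_left.mp hdisj hx' hx
      have hx' : x ∈ range G.jA ∪ range G.jB := G.range_union ▸ Set.mem_univ x
      exact hx'.resolve_left hx
    have hopen : IsOpen (range G.jA) := by
      rw [← compl_compl (range G.jA), hcompl]
      exact G.isClosed_range_jB.isOpen_compl
    have hexc := relativeSingularHomology.isIso_map_of_closure_subset_interior_holds ℤ ℤ M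
      (A := range G.jA) (U := range G.jA)
      (by rw [G.isClosed_range_jA.closure_eq, hopen.interior_eq])
    let e : B ≃ₜ ↥((range G.jA)ᶜ) :=
      G.isSmoothEmbedding_jB.isEmbedding.toHomeomorph.trans (Homeomorph.setCongr hcompl.symm)
    have hpre : (Subtype.val ⁻¹' range G.jA : Set ↥((range G.jA)ᶜ)) = ∅ :=
      Set.eq_empty_of_forall_notMem fun x hx => x.2 hx
    have he : MapsTo e dB (Subtype.val ⁻¹' range G.jA) := by
      rw [hdBempty]; exact mapsTo_empty _ _
    have he' : MapsTo e.symm (Subtype.val ⁻¹' range G.jA) dB := by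
      rw [hpre]; exact mapsTo_empty _ _
    let ex : ∀ k, relativeSingularHomology ℤ ℤ (↥((range G.jA)ᶜ)) (Subtype.val ⁻¹' range G.jA) k ≅
        relativeSingularHomology ℤ ℤ M (range G.jA) k := fun k =>
      @asIso _ _ _ _ (relativeSingularHomology.map ℤ ℤ (X := ↥((range G.jA)ᶜ))
        (subsetIncl ((range G.jA)ᶜ))
        (mapsTo_preimage Subtype.val (range G.jA) :
          MapsTo _ (Subtype.val ⁻¹' range G.jA) (range G.jA)) k) (hexc k)
    exact ⟨(hBd.of_homeomorph e he he').of_iso ex,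
      (relEuler_eq_of_iso ex).symm.trans (relEuler_eq_of_homeomorph e he he').symm⟩
  · let cA : NullCobordism (2 + 1) bA.carrier :=
      { W := A
        incl := bA.incl
        isSmoothEmbedding_incl := bA.isSmoothEmbedding
        range_incl := bA.range_incl }
    let cB : NullCobordism (2 + 1) bB.carrier :=
      { W := B
        incl := bB.incl
        isSmoothEmbedding_incl := bB.isSmoothEmbedding
        range_incl := bB.range_incl }
    let G' : BoundaryGluingData cA.boundaryData cB.boundaryData φ.toEquiv M :=
      { jA := G.jA
        jB := G.jB
        isSmoothEmbedding_jA := G.isSmoothEmbedding_jA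
        isSmoothEmbedding_jB := G.isSmoothEmbedding_jB
        range_union := G.range_union
        jA_eq_jB_iff := G.jA_eq_jB_iff }
    let ex : ∀ k, relativeSingularHomology ℤ ℤ B dB k ≅ relativeSingularHomology ℤ ℤ M (range G.jA) k :=
      fun k =>
      haveI := G'.isIso_map_jB_boundary' ℤ ℤ k
      asIso (relativeSingularHomology.map ℤ ℤ (⟨G'.jB, G'.continuous_jB⟩ : C(cB.W, M))
        G'.mapsTo_jB_boundary k)
    exact ⟨hBd.of_iso ex, (relEuler_eq_of_iso ex).symm⟩

/-- **`χ(A ∪_φ B) = χ(A) + χ(B) - χ(∂A)`** with finiteness, for a boundary gluing of compact smooth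
4-manifolds with boundary (Hatcher Thm. 2.44 along `∅ ⊆ jA A ⊆ M` and the excision above).  Private
copy of `finRelHomology_and_relEuler_of_isBoundaryGluing` at `m = 2`, integer coefficients. [folklore] -/
private theorem finRelHomology_and_relEuler_of_isBoundaryGluing'
    (bA : BoundaryData (𝓡∂ (2 + 1 + 1)) A (𝓡 (2 + 1))) (bB : BoundaryData (𝓡∂ (2 + 1 + 1)) B (𝓡 (2 + 1)))
    (φ : bA.carrier ≃ₘ⟮𝓡 (2 + 1), 𝓡 (2 + 1)⟯ bB.carrier)
    (h : IsBoundaryGluing bA bB φ (𝓡 (2 + 1 + 1)) M) :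
    FinRelHomology ℤ ℤ M ∅ 6 ∧
      relEuler ℤ ℤ M ∅ = relEuler ℤ ℤ A ∅ + relEuler ℤ ℤ B ∅ - relEuler ℤ ℤ bA.carrier ∅ := by
  obtain ⟨G⟩ := h.nonempty_boundaryGluingData'
  obtain ⟨hMA, hMAe⟩ := finRelHomology_and_relEuler_range_jA' bA bB φ G
  have hseam : relEuler ℤ ℤ bB.carrier ∅ = relEuler ℤ ℤ bA.carrier ∅ :=
    (relEuler_eq_of_homeomorph φ.toHomeomorph (mapsTo_empty _ _) (mapsTo_empty _ _)).symm
  let eA : A ≃ₜ ↥(range G.jA) := G.isSmoothEmbedding_jA.isEmbedding.toHomeomorph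
  have hAj : FinRelHomology ℤ ℤ (↥(range G.jA)) (Subtype.val ⁻¹' (∅ : Set M)) 6 := by
    rw [preimage_empty]
    exact ((finRelHomology_of_compactSpace_halfSpace (n := 2 + 1) A).of_homeomorph eA
      (mapsTo_empty _ _) (mapsTo_empty _ _)).mono (by omega)
  have hAje : relEuler ℤ ℤ (↥(range G.jA)) (Subtype.val ⁻¹' (∅ : Set M)) = relEuler ℤ ℤ A ∅ := by
    rw [preimage_empty]
    exact (relEuler_eq_of_homeomorph eA (mapsTo_empty _ _) (mapsTo_empty _ _)).symm
  obtain ⟨hM, hMe⟩ := FinRelHomology.triple_mid (R := ℤ) (M := ℤ) (empty_subset (range G.jA)) hAj hMA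
  refine ⟨hM, ?_⟩
  rw [hMe, hAje, hMAe, hseam]
  ring

end Copies

/-! ## The Euler characteristic of the base from its Betti numbers -/

section BaseEuler

/-- **`χ(Base g) = 1 - 2g` from the rational Betti numbers `b₀ = 1`, `b₁ = 2g`, `bₖ = 0` (`k ≥ 2`)**:
`χ = Σ_{k<5} (-1)ᵏ rank Hₖ(Base g; ℤ)` (the base is a compact smooth 4-manifold with boundary, so its
integral homology is finitely generated and vanishes above degree `4`), and
`rank Hₖ(·; ℤ) = dim Hₖ(·; ℚ)` (`bettiNumber_int_eq_rat`, Hatcher Cor. 3A.6). [folklore] -/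
theorem relEuler_base_of_betti (g : ℕ)
    (hB : bettiNumber ℚ (Base g) 0 = 1 ∧ bettiNumber ℚ (Base g) 1 = 2 * g ∧
      ∀ k, 2 ≤ k → bettiNumber ℚ (Base g) k = 0) :
    relEuler ℤ ℤ (Base g) ∅ = 1 - 2 * g := by
  have hF : FinRelHomology ℤ ℤ (Base g) ∅ 5 := finRelHomology_of_compactSpace_halfSpace (n := 3) (Base g)
  rw [hF.relEuler_empty_eq_sum]
  have hb : ∀ k, (Module.finrank ℤ (singularHomology ℤ ℤ (Base g) k) : ℤ) = bettiNumber ℚ (Base g) k :=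
    fun k => by rw [← bettiNumber_int_eq_rat]; rfl
  simp only [hb, Finset.sum_range_succ, Finset.sum_range_zero, hB.1, hB.2.1,
    hB.2.2 2 le_rfl, hB.2.2 3 (by norm_num), hB.2.2 4 (by norm_num)]
  push_cast
  ring

end BaseEuler

/-! ## The registered sub-goal: `l.length = 4 * g` -/

section SubGoal

/-- **Sub-goal `stub_modelsOn_counts_length_of_betti` of stub `stub_modelsOn_counts`** (line
`modp-braid-orbits`, r9): the first clause `l.length = 4 * g` of
`LefschetzBase.modelsOn_counts_of_homotopyEquiv_sphere` (Gompf–Stipsicz 1999, §8.2), CONDITIONAL on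
(`hχ`) the Euler characteristic `χ(X) = χ(Base g) + n` of a Kosinski multi-attachment of `n` 2-handles on
the base (Kosinski 1993, VI §6 / Kirby 1989, I §1) and (`hB`) the rational Betti numbers of the base
(`b₀ = 1`, `b₁ = 2g`, `bₖ = 0` for `k ≥ 2`; Milnor 1968 Thm. 9.1, `Base g ≃ F_{g,1} × D²`).  Proof:
`2 = χ(M)` (`M ≃ₕ S⁴`) `= χ(X) + χ(Base g) - χ(∂X)` (gluing count) `= (1 - 2g + n) + (1 - 2g) - 0`
(`χ` of the closed 3-manifold `∂X` vanishes). [folklore] -/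
theorem stub_modelsOn_counts_length_of_betti :
    (∀ (g n : ℕ) (h : Fin n → HandleAttachingMap 3 2 (Base g)) (X : Type) [TopologicalSpace X]
      [T2Space X] [SecondCountableTopology X] [CompactSpace X] [ChartedSpace (EuclideanHalfSpace 4) X]
      [IsManifold (𝓡∂ 4) ∞ X], HandleAttachingMap.IsMultiAttachment h (𝓡∂ 4) X →
      relEuler ℤ ℤ X ∅ = relEuler ℤ ℤ (Base g) ∅ + n) →
    (∀ g : ℕ, bettiNumber ℚ (Base g) 0 = 1 ∧ bettiNumber ℚ (Base g) 1 = 2 * g ∧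
      ∀ k, 2 ≤ k → bettiNumber ℚ (Base g) k = 0) →
    ∀ (M : Type) [TopologicalSpace M] [T2Space M] [SecondCountableTopology M]
      [ChartedSpace (EuclideanSpace ℝ (Fin 4)) M] [IsManifold (𝓡 4) ∞ M] (g : ℕ)
      (l : List ((Fin g ⊕ Fin g → ℤ) × Bool)),
      M ≃ₕ Metric.sphere (0 : EuclideanSpace ℝ (Fin 5)) 1 → ModelsOn M g l → l.length = 4 * g := by
  intro hχ hB M _ _ _ _ _ g l e hM
  obtain ⟨X, _, _, _, _, _, _, bX, Ψ, ⟨h, -, hmulti⟩, hglue⟩ := hM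
  -- `χ(M) = 2`, `χ(X) = χ(Base g) + |l|`, `χ(Base g) = 1 - 2g`, `χ(∂X) = 0`
  have hM2 : relEuler ℤ ℤ M ∅ = 2 := (finRelHomology_of_homotopyEquiv_sphere_four e).2
  have hX : relEuler ℤ ℤ X ∅ = relEuler ℤ ℤ (Base g) ∅ + l.length := hχ g l.length h X hmulti
  have hBg : relEuler ℤ ℤ (Base g) ∅ = 1 - 2 * g := relEuler_base_of_betti g (hB g)
  haveI : CompactSpace bX.carrier := bX.compactSpace_carrier
  haveI : T2Space bX.carrier := bX.isSmoothEmbedding.isEmbedding.t2Space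
  have hS : relEuler ℤ ℤ bX.carrier ∅ = 0 := relEuler_eq_zero_of_odd' (n := 3) (by decide) bX.carrier
  -- the gluing count, instances re-read at `2 + 1 + 1` (the base's own instances are synthesised
  -- before the bridging copies enter the local context)
  have iB2' : IsManifold (𝓡∂ 4) ∞ (Base g) := inferInstance
  letI iA1 : ChartedSpace (EuclideanHalfSpace (2 + 1 + 1)) X := ‹ChartedSpace (EuclideanHalfSpace 4) X›
  letI iA2 : IsManifold (𝓡∂ (2 + 1 + 1)) ∞ X := ‹IsManifold (𝓡∂ 4) ∞ X›
  letI iB1 : ChartedSpace (EuclideanHalfSpace (2 + 1 + 1)) (Base g) :=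
    (inferInstance : ChartedSpace (EuclideanHalfSpace 4) (Base g))
  letI iB2 : IsManifold (𝓡∂ (2 + 1 + 1)) ∞ (Base g) := iB2'
  letI iM1 : ChartedSpace (EuclideanSpace ℝ (Fin (2 + 1 + 1))) M :=
    ‹ChartedSpace (EuclideanSpace ℝ (Fin 4)) M›
  letI iM2 : IsManifold (𝓡 (2 + 1 + 1)) ∞ M := ‹IsManifold (𝓡 4) ∞ M›
  letI ia3 : ChartedSpace (EuclideanSpace ℝ (Fin (2 + 1))) bX.carrier := bX.chartedSpace
  letI ia4 : IsManifold (𝓡 (2 + 1)) ∞ bX.carrier := bX.isManifold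
  letI ib3 : ChartedSpace (EuclideanSpace ℝ (Fin (2 + 1))) (bBase g).carrier := (bBase g).chartedSpace
  letI ib4 : IsManifold (𝓡 (2 + 1)) ∞ (bBase g).carrier := (bBase g).isManifold
  have hglue' := (finRelHomology_and_relEuler_of_isBoundaryGluing' bX (bBase g) Ψ hglue).2
  rw [hM2, hX, hBg, hS] at hglue'
  omega

end SubGoal

end Summit.SmoothPoincare4.SmoothPoincare4.Theorems.AcyclicBisectionExists.ModpBraidOrbits

end
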